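import Summits.AtomisticToContinuum.BoseEinsteinCondensation.Theorems.GaussianDominationCan.Negative.CruxForms

/-!
# Crux `GaussianDominationCan` — load-bearing hypotheses

Crux disprover results for `stmt-AtomisticToContinuum-9479` (route BECThomsonPrinciple):
* `gaussianDominationCan_iff_noN₀` — `N₀` is NOT load-bearing (equivalent statement with `N₀ = 0`);
* `gaussianDominationCan_false_without_n_ne_zero` — any proof must use `n ≠ 0`;
* `gaussianDominationCan_false_without_symm` — any proof must use the Bose symmetry of the trial
  class (the factor `2(m+1)` is calibrated to it): for `v = 0` the state `φ ⊗ c^{⊗(N-1)}` has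
  susceptibility/penalty `∼ N`.
All [folklore] (elementary witnesses).
-/

noncomputable section

namespace Summit.AtomisticToContinuum.BoseEinsteinCondensation.Theorems.GaussianDominationCan.Negative

open MeasureTheory Literature.MathematicalPhysics.QuantumManyBody.BoseGas
open scoped ENNReal NNReal ComplexConjugate

variable {N : ℕ} {L : ℝ}

/-! ## §A Load-bearing hypotheses -/

section LoadBearing

/-! ### A1. `N₀` is NOT load-bearing (redundant given the freedom in `ρ₀`) -/

/-- The window forces `4π² L ≤ M² N` (from `‖n‖ ≥ 1`). -/
theorem side_le_of_inWindow {M : ℝ} {m : ℕ} {n : Fin 3 → ℤ} (hL : 0 < L) (hn : n ≠ 0)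
    (hw : InWindow M m L n) : 4 * Real.pi ^ 2 * L ≤ M ^ 2 * ((m + 1 : ℕ) : ℝ) := by
  unfold InWindow at hw
  set N : ℝ := ((m + 1 : ℕ) : ℝ)
  have hM : 0 ≤ M * Real.sqrt (N / L ^ 3) := le_trans (by positivity) hw
  have h1 : 2 * Real.pi / L ≤ 2 * Real.pi * ‖(fun j => (n j : ℝ))‖ / L := by
    rw [div_le_div_iff_of_pos_right hL]
    nlinarith [one_le_norm_intVec hn, Real.pi_pos]
  have h2 := h1.trans hw
  have h3 : (2 * Real.pi / L) ^ 2 ≤ (M * Real.sqrt (N / L ^ 3)) ^ 2 :=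
    pow_le_pow_left₀ (by positivity) h2 2
  rw [mul_pow, Real.sq_sqrt (by positivity), div_pow, div_le_iff₀ (by positivity)] at h3
  have : M ^ 2 * (N / L ^ 3) * L ^ 2 = M ^ 2 * N / L := by field_simp
  rw [this, le_div_iff₀ hL] at h3
  nlinarith [h3]

/-- Shrinking `ρ₀` makes every `N < N₀` inadmissible, so `N₀` can be taken to be `0`. -/
theorem gdCanWith_zero_of {ρ₀ C M : ℝ} {N₀ : ℕ} {v : ℝ → ℝ≥0∞} (hM : 0 < M)
    (h : GDCanWith ρ₀ C N₀ v M) :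
    GDCanWith (min ρ₀ (64 * Real.pi ^ 6 / (M ^ 6 * ((N₀ : ℝ) + 1) ^ 2))) C 0 v M := by
  intro m _ L hL hdens n hn hw s hs Φ
  refine h m ?_ L hL
    (hdens.trans (mul_le_mul_of_nonneg_right (min_le_left _ _) (by positivity))) n hn hw s hs Φ
  set N : ℝ := ((m + 1 : ℕ) : ℝ) with hNdef
  have hNpos : 0 < N := by positivity
  have hwin := side_le_of_inWindow hL hn hw
  have hd2 : N ≤ 64 * Real.pi ^ 6 / (M ^ 6 * ((N₀ : ℝ) + 1) ^ 2) * L ^ 3 :=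
    hdens.trans (mul_le_mul_of_nonneg_right (min_le_right _ _) (by positivity))
  have hL3 : L ^ 3 ≤ (M ^ 2 * N / (4 * Real.pi ^ 2)) ^ 3 :=
    pow_le_pow_left₀ hL.le (by rw [le_div_iff₀ (by positivity)]; linarith [hwin]) 3
  have h4 := hd2.trans (mul_le_mul_of_nonneg_left hL3 (by positivity))
  have h5 : 64 * Real.pi ^ 6 / (M ^ 6 * ((N₀ : ℝ) + 1) ^ 2) * (M ^ 2 * N / (4 * Real.pi ^ 2)) ^ 3 =
      N ^ 3 / ((N₀ : ℝ) + 1) ^ 2 := by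
    field_simp
    ring
  rw [h5, le_div_iff₀ (by positivity)] at h4
  have h6 : ((N₀ : ℝ) + 1) ^ 2 ≤ N ^ 2 := le_of_mul_le_mul_left (by nlinarith [h4]) hNpos
  have h7 : (N₀ : ℝ) + 1 ≤ N :=
    (pow_le_pow_iff_left₀ (by positivity) (by positivity) two_ne_zero).mp h6
  have h8 : ((N₀ + 1 : ℕ) : ℝ) ≤ ((m + 1 : ℕ) : ℝ) := by rw [← hNdef]; exact_mod_cast h7
  have h9 : N₀ + 1 ≤ m + 1 := by exact_mod_cast h8
  omega

/-- **`N₀` is redundant**: the crux is equivalent to its `N₀ = 0` instance. Any proof may take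
`N₀ = 0` after shrinking `ρ₀`; any disproof must work at arbitrarily large `N`. -/
theorem gaussianDominationCan_iff_noN₀ :
    Summit.AtomisticToContinuum.BoseEinsteinCondensation.Theses.BECThomsonPrinciple.GaussianDominationCan ↔
      ∀ v : ℝ → ℝ≥0∞, IsRepulsiveFiniteRange v → ∀ M : ℝ, 0 < M →
        ∃ ρ₀ C : ℝ, 0 < ρ₀ ∧ 0 < C ∧ GDCanWith ρ₀ C 0 v M := by
  rw [gaussianDominationCan_iff]
  refine ⟨fun h v hv M hM => ?_, fun h v hv M hM => ?_⟩
  · obtain ⟨ρ₀, C, hρ, hC, N₀, hG⟩ := h v hv M hM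
    exact ⟨_, C, lt_min hρ (by positivity), hC, gdCanWith_zero_of hM hG⟩
  · obtain ⟨ρ₀, C, hρ, hC, hG⟩ := h v hv M hM
    exact ⟨ρ₀, C, hρ, hC, 0, hG⟩

/-! ### A2. `n ≠ 0` IS load-bearing -/

/-- The crux with the hypothesis `n ≠ 0` deleted (then `‖n‖ = 0` kills the penalty while the
constant state still has source `2√N`). -/
def GaussianDominationCanWithoutNNeZero : Prop :=
  ∀ v : ℝ → ℝ≥0∞, IsRepulsiveFiniteRange v → ∀ M : ℝ, 0 < M → ∃ ρ₀ C : ℝ, 0 < ρ₀ ∧ 0 < C ∧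
    ∃ N₀ : ℕ, ∀ m : ℕ, N₀ ≤ m + 1 → ∀ L : ℝ, 0 < L → ((m + 1 : ℕ) : ℝ) ≤ ρ₀ * L ^ 3 →
      ∀ n : Fin 3 → ℤ, InWindow M m L n → ∀ s : ℝ, 0 ≤ s →
        ∀ Φ : PeriodicTrialState (m + 1) L, GDIneq v m L n C s Φ

/-- **Any proof must use `n ≠ 0`**: witness `v = 0`, `n = 0`, `s = 1`, the constant state. -/
theorem gaussianDominationCan_false_without_n_ne_zero : ¬ GaussianDominationCanWithoutNNeZero := by
  intro h
  obtain ⟨ρ₀, C, hρ, _, N₀, hG⟩ := h 0 isRepulsiveFiniteRange_zero 1 one_pos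
  set L : ℝ := max 1 (((N₀ + 1 : ℕ) : ℝ) / ρ₀) with hLdef
  have hL1 : 1 ≤ L := le_max_left _ _
  have hL : 0 < L := lt_of_lt_of_le one_pos hL1
  have hdens : ((N₀ + 1 : ℕ) : ℝ) ≤ ρ₀ * L ^ 3 := by
    have h1 : ((N₀ + 1 : ℕ) : ℝ) / ρ₀ ≤ L := le_max_right _ _
    have h2 : ((N₀ + 1 : ℕ) : ℝ) ≤ ρ₀ * L := by rwa [div_le_iff₀' hρ] at h1
    have h3 : L ≤ L ^ 3 := le_self_pow₀ hL1 (by norm_num)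
    nlinarith [h2, h3, hρ]
  have hwin : InWindow 1 N₀ L 0 := by
    unfold InWindow
    simp only [Int.cast_zero, Pi.zero_apply]
    rw [show (fun _ : Fin 3 => (0 : ℝ)) = 0 from rfl, norm_zero, mul_zero, zero_div]
    positivity
  set c : ℝ := Real.sqrt ((L ^ 3)⁻¹) with hcdef
  have hc : c ^ 2 * L ^ 3 = 1 := by
    rw [hcdef, Real.sq_sqrt (by positivity), inv_mul_cancel₀ (by positivity)]
  have key := hG N₀ (Nat.le_succ N₀) L hL hdens 0 hwin 1 zero_le_one (constState N₀ hL c hc)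
  unfold GDIneq at key
  rw [periodicEnergy_constState hL hc] at key
  have hpen : ENNReal.ofReal (C * 1 ^ 2 * L ^ 2 / ‖(fun j => ((0 : Fin 3 → ℤ) j : ℝ))‖ ^ 2) = 0 := by
    simp only [Int.cast_zero, Pi.zero_apply]
    rw [show (fun _ : Fin 3 => (0 : ℝ)) = 0 from rfl, norm_zero]
    simp
  rw [hpen, add_zero] at key
  have hsrc : 0 < 1 * (2 * ((N₀ : ℝ) + 1) * ‖sourceIntegral N₀ L 0 (constState N₀ hL c hc).ψ‖) := by
    show 0 < 1 * (2 * ((N₀ : ℝ) + 1) * ‖sourceIntegral N₀ L 0 (constFun N₀ c)‖)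
    rw [sourceIntegral_constFun hL hc, norm_inv, Complex.norm_real, Real.norm_of_nonneg
      (Real.sqrt_nonneg _)]
    have : 0 < Real.sqrt ((N₀ : ℝ) + 1) := Real.sqrt_pos.mpr (by positivity)
    positivity
  have h0 := le_add_self.trans key
  rw [nonpos_iff_eq_zero, ENNReal.ofReal_eq_zero] at h0
  linarith

/-! ### A3. Bose symmetry of the trial class IS load-bearing (the factor `2(m+1)` is calibrated
to it) -/

/-- The crux with the Bose symmetry of the trial state dropped (everything else verbatim:
`C¹`, periodic, normalised; `E₀` still the bosonic ground-state energy). -/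
def GaussianDominationCanWithoutSymm : Prop :=
  ∀ v : ℝ → ℝ≥0∞, IsRepulsiveFiniteRange v → ∀ M : ℝ, 0 < M → ∃ ρ₀ C : ℝ, 0 < ρ₀ ∧ 0 < C ∧
    ∃ N₀ : ℕ, ∀ m : ℕ, N₀ ≤ m + 1 → ∀ L : ℝ, 0 < L → ((m + 1 : ℕ) : ℝ) ≤ ρ₀ * L ^ 3 →
      ∀ n : Fin 3 → ℤ, n ≠ 0 → InWindow M m L n → ∀ s : ℝ, 0 ≤ s →
        ∀ ψ : Config (m + 1) → ℂ, ContDiff ℝ 1 ψ →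
          (∀ (X : Config (m + 1)) (i : Fin (m + 1)) (k : Fin 3),
            ψ (X + Pi.single i (EuclideanSpace.single k L)) = ψ X) →
          ∫⁻ X in cellN (m + 1) L, (‖ψ X‖₊ : ℝ≥0∞) ^ 2 = 1 →
          periodicGroundStateEnergy v (m + 1) L +
              ENNReal.ofReal (s * (2 * (m + 1) * ‖sourceIntegral m L n ψ‖)) ≤
            rawEnergy v (m + 1) L ψ +
              ENNReal.ofReal (C * s ^ 2 * L ^ 2 / ‖(fun j => (n j : ℝ))‖ ^ 2)

/-- **Any proof must use Bose symmetry**: for `v = 0` the state `φ ⊗ c^{⊗(N-1)}` has source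
`√N` at energy `2π²/L²`, so the susceptibility per unit penalty grows like `N`. -/
theorem gaussianDominationCan_false_without_symm : ¬ GaussianDominationCanWithoutSymm := by
  intro h
  obtain ⟨ρ₀, C, hρ, hCpos, N₀, hG⟩ := h 0 isRepulsiveFiniteRange_zero 1 one_pos
  obtain ⟨m, hmN₀, hmT⟩ := exists_large N₀ (64 * Real.pi ^ 6 / (ρ₀ * 1 ^ 6) + 16 * Real.pi ^ 2 * C)
  set N : ℝ := ((m + 1 : ℕ) : ℝ) with hNdef
  have hNpos : 0 < N := by positivity
  have hKN : 64 * Real.pi ^ 6 / (ρ₀ * 1 ^ 6) ≤ N := by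
    have : 0 ≤ 16 * Real.pi ^ 2 * C := by positivity
    linarith
  have hNC : 8 * Real.pi ^ 2 * C < N := by
    have : 0 ≤ 64 * Real.pi ^ 6 / (ρ₀ * 1 ^ 6) := by positivity
    nlinarith [hmT, Real.pi_pos, hCpos]
  obtain ⟨hL, hdens, hwin⟩ := corner one_pos hρ m hKN
  set L : ℝ := 1 ^ 2 * N / (4 * Real.pi ^ 2) with hLdef
  -- amplitudes
  set a : ℝ := Real.sqrt (1 / (2 * L ^ 3)) with hadef
  set c : ℝ := Real.sqrt ((L ^ 3)⁻¹) with hcdef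
  have ha2 : a ^ 2 * L ^ 3 = 1 / 2 := by
    rw [hadef, Real.sq_sqrt (by positivity)]; field_simp
  have hab : (a ^ 2 + a ^ 2) * L ^ 3 = 1 := by linarith [ha2]
  have hc : c ^ 2 * L ^ 3 = 1 := by
    rw [hcdef, Real.sq_sqrt (by positivity), inv_mul_cancel₀ (by positivity)]
  have ha : 0 ≤ a := Real.sqrt_nonneg _
  have hN' : (m : ℝ) + 1 = N := by rw [hNdef]; push_cast; ring
  set u : ℝ := N * (Real.sqrt N)⁻¹ with hudef
  have hu2 : u ^ 2 = N := by
    rw [hudef, mul_pow, inv_pow, Real.sq_sqrt hNpos.le]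
    field_simp
  have hupos : 0 < u := by positivity
  set s : ℝ := u / (2 * C * L ^ 2) with hsdef
  have hs : 0 ≤ s := by positivity
  have key := hG m hmN₀ L hL hdens e0 e0_ne_zero hwin s hs (nsFun m L e0 a a c)
    (contDiff_nsFun L e0 a a c) (nsFun_periodic hL.ne') (lintegral_nnnorm_sq_nsFun hL e0_ne_zero hab hc)
  rw [rawEnergy_nsFun hL hc, norm_sourceIntegral_nsFun hL e0_ne_zero ha ha hc, norm_e0, nsq_e0,
    one_pow, div_one] at key
  have hE : 0 ≤ a ^ 2 * L ^ 3 * (4 * Real.pi ^ 2 * 1 / L ^ 2) := by positivity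
  have hpen : 0 ≤ C * s ^ 2 * L ^ 2 := by positivity
  rw [← ENNReal.ofReal_add hE hpen] at key
  have hreal := (ENNReal.ofReal_le_ofReal_iff (add_nonneg hE hpen)).mp (le_add_self.trans key)
  rw [hN'] at hreal
  have hLa : L ^ 3 * a * a = 1 / 2 := by rw [← ha2]; ring
  rw [hLa, ha2] at hreal
  -- hreal : s * (2 * N * ((√N)⁻¹ * (1 / 2))) ≤ 1 / 2 * (4π²·1/L²) + C s² L²
  have e1 : s * (2 * N * ((Real.sqrt N)⁻¹ * (1 / 2))) = u ^ 2 / (2 * C * L ^ 2) := by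
    rw [hsdef, hudef]
    field_simp
  have e2 : C * s ^ 2 * L ^ 2 = u ^ 2 / (4 * C * L ^ 2) := by
    rw [hsdef]
    field_simp
    ring
  have e3 : 1 / 2 * (4 * Real.pi ^ 2 * 1 / L ^ 2) = 2 * Real.pi ^ 2 / L ^ 2 := by
    field_simp
    ring
  rw [e1, e2, e3] at hreal
  have h1 : u ^ 2 / (4 * C * L ^ 2) ≤ 2 * Real.pi ^ 2 / L ^ 2 := by
    have : u ^ 2 / (2 * C * L ^ 2) = 2 * (u ^ 2 / (4 * C * L ^ 2)) := by
      field_simp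
      norm_num
    linarith
  rw [div_le_div_iff₀ (by positivity) (by positivity)] at h1
  have h2 : u ^ 2 ≤ 8 * Real.pi ^ 2 * C := by
    have hL2 : 0 < L ^ 2 := by positivity
    have h3 : u ^ 2 * L ^ 2 ≤ (8 * Real.pi ^ 2 * C) * L ^ 2 := by linarith
    exact le_of_mul_le_mul_right h3 hL2
  rw [hu2] at h2
  linarith

end LoadBearing

end Summit.AtomisticToContinuum.BoseEinsteinCondensation.Theorems.GaussianDominationCan.Negative

end
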